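import Summits.NavierStokesRegularity.FunctionalMining.NoGo.MiddleEigenvalueKillAllSixProfiles
import Summits.NavierStokesRegularity.FunctionalMining.MiddleEigenvalueMomentDoor
import Mathlib.Analysis.Calculus.BumpFunction.InnerProduct
import Mathlib.Analysis.Calculus.LocalExtr.Basic
import Mathlib.MeasureTheory.Integral.IntegralEqImproper
import Mathlib.MeasureTheory.Measure.Haar.NormedSpace
import HarnessLib

/-!
# K1-Q2 KILL-ALL WITNESS, part 6/6: `∫|ω|⁴σ > 0` and `∀ C, ¬ MiddleEigenvalueMomentRateBound 6 C`

Search for candidate a priori estimates; no regularity claim. NS FUNCTIONAL MINING — NO-GO BRANCH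
(cell `pub-nsfunc`, no-go seat gen 7).
**Theorem (`not_middleEigenvalueMomentRateBound_six`).** For every `C : ℝ` the conjectural
middle-eigenvalue moment rate law at `q = 6`, `MiddleEigenvalueMomentRateBound (d := Fin 3) 6 C`
(`dZ₆/dt ≤ C Λ Z₆` whenever `λ₂(S) ≤ Λ` pointwise; dictionary row E.q=6 of the D2a moment ladder), is
FALSE: the explicit field `KillAll.fld` (parts 3–4; `λ₂ ≡ 0`) has
`∫_{T³} |ω|⁴ σ = 168π² XY + 120π² ZW + 90π⁴ X₃ Y > 0` with the bump moments `X = ∫tA² > 0`,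
`Y = ∫tA'² > 0`, `Z = ∫tA'⁴ ≥ 0`, `W = ∫tA⁴ ≥ 0`, `X₃ = ∫t³A² ≥ 0` (46 separable monomials, Fubini, the
part-5 facts), and the door `middleEigenvalueMomentRateFails_of_nonpos_middle` at `m = 3` concludes.
Together with part 4 (`q = 4`): CONJECTURE S⁻(m) is false in the kernel for `m = 2, 3`.
Nothing is asserted about Navier–Stokes regularity.
-/

noncomputable section

open MeasureTheory Set Function Filter Topology Metric
open scoped ContDiff Real

namespace Summit.NavierStokesRegularity.FunctionalMining

namespace KillAll

open Literature.Analysis Literature.Analysis.FluidPDE Literature.Analysis.FunctionSpaces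
  Literature.Analysis.FunctionSpaces.Torus

/-! ## Sixth moment: `∫ |ω|⁴ σ = 168π² XY + 120π² ZW + 90π⁴ X₃Y > 0` and `q = 6` -/

/-- The nine vertical factors `Vⁱ Vz'ʲ` occurring at `m = 3`. -/
def gam6 : Fin 9 → ℝ → ℝ
  | 0 => fun t => Vz t * dVz t
  | 1 => fun t => Vz t * dVz t ^ 3
  | 2 => fun t => Vz t * dVz t ^ 2
  | 3 => fun t => Vz t ^ 3 * dVz t
  | 4 => fun t => Vz t * dVz t ^ 4
  | 5 => fun t => Vz t * dVz t ^ 5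
  | 6 => fun t => Vz t ^ 3 * dVz t ^ 2
  | 7 => fun t => Vz t ^ 3 * dVz t ^ 3
  | 8 => fun t => Vz t ^ 5 * dVz t

/-- Their integrals over `[0,1]`. -/
def gamInt6 : Fin 9 → ℝ
  | 2 => 2 * π ^ 2
  | 4 => 6 * π ^ 4
  | 6 => 7 / 2 * π ^ 2
  | _ => 0

/-- Auxiliary declaration `integral_gam6` of the q = 6 witness (file 6/6) (NOGO N11 kill-all chain; search for candidate a priori estimates; no regularity claim). -/
theorem integral_gam6 (z : Fin 9) : ∫ t in (0 : ℝ)..1, gam6 z t = gamInt6 z := by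
  fin_cases z
  · exact (by simpa using integral_VdV_odd 1 1 (by decide) : ∫ t in (0 : ℝ)..1, Vz t * dVz t = 0)
  · exact (by simpa using integral_VdV_odd 1 3 (by decide) :
      ∫ t in (0 : ℝ)..1, Vz t * dVz t ^ 3 = 0)
  · exact integral_V_dV2
  · exact (by simpa using integral_VdV_odd 3 1 (by decide) :
      ∫ t in (0 : ℝ)..1, Vz t ^ 3 * dVz t = 0)
  · exact integral_V_dV4
  · exact (by simpa using integral_VdV_odd 1 5 (by decide) :
      ∫ t in (0 : ℝ)..1, Vz t * dVz t ^ 5 = 0)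
  · exact integral_V3_dV2
  · exact (by simpa using integral_VdV_odd 3 3 (by decide) :
      ∫ t in (0 : ℝ)..1, Vz t ^ 3 * dVz t ^ 3 = 0)
  · exact (by simpa using integral_VdV_odd 5 1 (by decide) :
      ∫ t in (0 : ℝ)..1, Vz t ^ 5 * dVz t = 0)

/-- Auxiliary declaration `continuous_gam6` of the q = 6 witness (file 6/6) (NOGO N11 kill-all chain; search for candidate a priori estimates; no regularity claim). -/
theorem continuous_gam6 (z : Fin 9) : Continuous (gam6 z) := by
  fin_cases z
  · exact continuous_Vz.mul continuous_dVz
  · exact continuous_Vz.mul (continuous_dVz.pow 3)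
  · exact continuous_Vz.mul (continuous_dVz.pow 2)
  · exact (continuous_Vz.pow 3).mul continuous_dVz
  · exact continuous_Vz.mul (continuous_dVz.pow 4)
  · exact continuous_Vz.mul (continuous_dVz.pow 5)
  · exact (continuous_Vz.pow 3).mul (continuous_dVz.pow 2)
  · exact (continuous_Vz.pow 3).mul (continuous_dVz.pow 3)
  · exact (continuous_Vz.pow 5).mul continuous_dVz

/-- A row of the `m = 3` table (same shape as `Row`, vertical factor among nine). -/
structure Row6 where
  /-- integer coefficient -/
  c : ℤ
  /-- `x`-weight exponent -/
  a : ℕ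
  /-- `x`-profile exponent -/
  b : ℕ
  /-- `x`-profile-derivative exponent -/
  e : ℕ
  /-- `y`-weight exponent -/
  a' : ℕ
  /-- `y`-profile exponent -/
  b' : ℕ
  /-- `y`-profile-derivative exponent -/
  e' : ℕ
  /-- vertical factor -/
  z : Fin 9

/-- The `m = 2` row with the same horizontal exponents (to reuse `Row.α`, `Row.β`). -/
def Row6.toRow (r : Row6) : Row := ⟨r.c, r.a, r.b, r.e, r.a', r.b', r.e', 0⟩

/-- Pointwise value of a row (without its coefficient). -/
def Row6.fn (r : Row6) (y : E3) : ℝ := r.toRow.α (y 0) * r.toRow.β (y 1) * gam6 r.z (y 2)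

/-- Integrated value of a row (without its coefficient). -/
def Row6.val (r : Row6) : ℝ := Ia r.a r.b r.e * Ib r.a' r.b' r.e' * gamInt6 r.z

/-- Coordinate projections of `E3` are continuous (private copy of the file-4 helper, which is private there). [folklore] -/
private theorem continuous_coord' (a : Fin 3) : Continuous fun y : E3 => y a :=
  (continuous_apply a).comp (PiLp.continuous_ofLp 2 _)

/-- Auxiliary declaration `Row6.continuous_fn` of the q = 6 witness (file 6/6) (NOGO N11 kill-all chain; search for candidate a priori estimates; no regularity claim). -/
theorem Row6.continuous_fn (r : Row6) : Continuous r.fn := by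
  unfold Row6.fn
  exact ((r.toRow.continuous_α.comp (continuous_coord' 0)).mul
    (r.toRow.continuous_β.comp (continuous_coord' 1))).mul
    ((continuous_gam6 r.z).comp (continuous_coord' 2))

/-- Auxiliary declaration `Row6.integral_fn` of the q = 6 witness (file 6/6) (NOGO N11 kill-all chain; search for candidate a priori estimates; no regularity claim). -/
theorem Row6.integral_fn (r : Row6) (hr : r.b ≠ 0 ∨ r.e ≠ 0) (hr' : r.b' ≠ 0 ∨ r.e' ≠ 0) :
    ∫ y in unitCube (Fin 3), r.fn y = r.val := by
  unfold Row6.fn Row6.val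
  rw [setIntegral_unitCube_sep r.toRow.α r.toRow.β (gam6 r.z) (fun t ht => r.toRow.α_eq_zero hr ht)
    (fun t ht => r.toRow.β_eq_zero hr' ht), integral_gam6]
  rfl

/-- **The 46 monomials of `|ω|⁴ σ`** for the witness (CAS-generated, kernel-checked below). -/
def table6 : List Row6 := [
  ⟨-64, 0, 1, 0, 1, 0, 1, 8⟩, ⟨-32, 0, 1, 0, 3, 0, 1, 7⟩, ⟨-4, 0, 1, 0, 5, 0, 1, 5⟩,
  ⟨-64, 0, 1, 1, 2, 1, 1, 6⟩, ⟨-16, 0, 1, 1, 4, 1, 1, 4⟩, ⟨-32, 0, 1, 2, 1, 2, 1, 3⟩,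
  ⟨-24, 0, 1, 2, 3, 2, 1, 1⟩, ⟨-16, 0, 1, 3, 2, 3, 1, 2⟩, ⟨-4, 0, 1, 4, 1, 4, 1, 0⟩,
  ⟨-32, 0, 3, 0, 1, 0, 3, 3⟩, ⟨-8, 0, 3, 0, 3, 0, 3, 1⟩, ⟨-16, 0, 3, 1, 2, 1, 3, 2⟩,
  ⟨-8, 0, 3, 2, 1, 2, 3, 0⟩, ⟨-4, 0, 5, 0, 1, 0, 5, 0⟩, ⟨-64, 1, 0, 1, 0, 1, 0, 8⟩,
  ⟨-32, 1, 0, 1, 2, 1, 0, 7⟩, ⟨-4, 1, 0, 1, 4, 1, 0, 5⟩, ⟨-64, 1, 0, 2, 1, 2, 0, 6⟩,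
  ⟨-16, 1, 0, 2, 3, 2, 0, 4⟩, ⟨-32, 1, 0, 3, 0, 3, 0, 3⟩, ⟨-24, 1, 0, 3, 2, 3, 0, 1⟩,
  ⟨-16, 1, 0, 4, 1, 4, 0, 2⟩, ⟨-4, 1, 0, 5, 0, 5, 0, 0⟩, ⟨64, 1, 2, 0, 1, 0, 2, 6⟩,
  ⟨16, 1, 2, 0, 3, 0, 2, 4⟩, ⟨-32, 1, 2, 1, 0, 1, 2, 3⟩, ⟨24, 1, 2, 1, 2, 1, 2, 1⟩,
  ⟨-8, 1, 2, 3, 0, 3, 2, 0⟩, ⟨16, 1, 4, 0, 1, 0, 4, 2⟩, ⟨-4, 1, 4, 1, 0, 1, 4, 0⟩,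
  ⟨-32, 2, 1, 0, 1, 0, 1, 7⟩, ⟨-8, 2, 1, 0, 3, 0, 1, 5⟩, ⟨64, 2, 1, 1, 0, 1, 1, 6⟩,
  ⟨24, 2, 1, 2, 1, 2, 1, 1⟩, ⟨16, 2, 1, 3, 0, 3, 1, 2⟩, ⟨-24, 2, 3, 0, 1, 0, 3, 1⟩,
  ⟨16, 2, 3, 1, 0, 1, 3, 2⟩, ⟨-32, 3, 0, 1, 0, 1, 0, 7⟩, ⟨-8, 3, 0, 1, 2, 1, 0, 5⟩,
  ⟨-16, 3, 0, 2, 1, 2, 0, 4⟩, ⟨-8, 3, 0, 3, 0, 3, 0, 1⟩, ⟨16, 3, 2, 0, 1, 0, 2, 4⟩,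
  ⟨-24, 3, 2, 1, 0, 1, 2, 1⟩, ⟨-4, 4, 1, 0, 1, 0, 1, 5⟩, ⟨16, 4, 1, 1, 0, 1, 1, 4⟩,
  ⟨-4, 5, 0, 1, 0, 1, 0, 5⟩]

/-- Auxiliary declaration `table6_exponents` of the q = 6 witness (file 6/6) (NOGO N11 kill-all chain; search for candidate a priori estimates; no regularity claim). -/
theorem table6_exponents : ∀ r ∈ table6, (r.b ≠ 0 ∨ r.e ≠ 0) ∧ (r.b' ≠ 0 ∨ r.e' ≠ 0) := by
  simp [table6]

/-- The three regimes of a point of the cube: inside the jet (rigid core), or one of the two jet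
profiles vanishes together with its derivative. -/
theorem trichotomy (y : E3) : (gc (rs y) = 1 ∧ deriv gc (rs y) = 0) ∨
    (A (sh (y 0)) = 0 ∧ deriv A (sh (y 0)) = 0) ∨
    (A (2 * sh (y 1)) = 0 ∧ deriv A (2 * sh (y 1)) = 0) := by
  by_cases hp : |pc y - 1 / 4| < 1 / 8
  · by_cases hq : |2 * qc y - 1 / 4| < 1 / 8
    · exact Or.inl (core_of_jet hp hq)
    · exact Or.inr (Or.inr (A_dA_eq_zero_of_not hq))
  · exact Or.inr (Or.inl (A_dA_eq_zero_of_not hp))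

/-- **Pointwise: `|ω|⁴ σ` of the witness is the sum of the 46 rows.** -/
theorem integrand6_eq (ξ : UnitAddTorus (Fin 3)) :
    torusVorticitySqAt fld ξ ^ 2 * torusStretchingDensity fld ξ =
      (table6.map fun r => (r.c : ℝ) * r.fn (repr ξ)).sum := by
  rcases trichotomy (repr ξ) with ⟨h1, h0⟩ | ⟨h1, h0⟩ | ⟨h1, h0⟩
  · simp only [torusVorticitySqAt, torusStretchingDensity, torusVorticityTensor, Fin.sum_univ_three,
      partialDeriv_fld]
    simp only [jac, pc, qc, Matrix.of_apply, Matrix.cons_val', Matrix.cons_val_zero,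
      Matrix.cons_val_one, Matrix.cons_val_two, Matrix.head_cons, Matrix.tail_cons,
      Matrix.empty_val', Matrix.cons_val_fin_one, Matrix.head_fin_const]
    simp only [table6, List.map_cons, List.map_nil, List.sum_cons, List.sum_nil, Row6.fn, Row6.toRow,
      Row.α, Row.β, gam6, pow_zero, pow_one, one_mul, mul_one, Int.cast_ofNat, Int.cast_neg]
    rw [h1, h0]
    ring
  · have hL : torusVorticitySqAt fld ξ * torusStretchingDensity fld ξ = 0 := by
      rw [integrand_eq]
      simp [table, Row.fn, Row.α, h1, h0]
    rw [pow_two, mul_assoc, hL, mul_zero]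
    symm
    simp [table6, Row6.fn, Row6.toRow, Row.α, h1, h0]
  · have hL : torusVorticitySqAt fld ξ * torusStretchingDensity fld ξ = 0 := by
      rw [integrand_eq]
      simp [table, Row.fn, Row.β, h1, h0]
    rw [pow_two, mul_assoc, hL, mul_zero]
    symm
    simp [table6, Row6.fn, Row6.toRow, Row.β, h1, h0]

/-- **`∫_{T³} |ω|⁴ σ = 168π² XY + 120π² ZW + 90π⁴ X₃Y` for the witness**, with the bump moments
`X = ∫tA²`, `Y = ∫tA'²`, `Z = ∫tA'⁴`, `W = ∫tA⁴`, `X₃ = ∫t³A²` (all `> 0` resp. `≥ 0`). -/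
theorem integral_vortSq2_mul_stretching :
    ∫ ξ, torusVorticitySqAt fld ξ ^ 2 * torusStretchingDensity fld ξ =
      168 * π ^ 2 * (Ia 1 2 0 * Ia 1 0 2) + 120 * π ^ 2 * (Ia 1 0 4 * Ia 1 4 0)
        + 90 * π ^ 4 * (Ia 3 2 0 * Ia 1 0 2) := by
  simp_rw [integrand6_eq]
  rw [integral_comp_repr (fun y : E3 => (table6.map fun r => (r.c : ℝ) * r.fn y).sum)]
  have hrow : ∀ r ∈ table6, Integrable r.fn (volume.restrict (unitCube (Fin 3))) :=
    fun r _ => integrableOn_unitCube r.continuous_fn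
  rw [Sep3.integral_listSum (fun r : Row6 => (r.c : ℝ)) (fun r => r.fn) table6 hrow]
  have hval : ∀ r ∈ table6, (r.c : ℝ) * ∫ y in unitCube (Fin 3), r.fn y = (r.c : ℝ) * r.val :=
    fun r hr => by rw [r.integral_fn (table6_exponents r hr).1 (table6_exponents r hr).2]
  rw [List.map_congr_left hval]
  simp only [table6, List.map_cons, List.map_nil, List.sum_cons, List.sum_nil, Row6.val, gamInt6,
    Ib_eq, Ia_011, Ia_013, Ia_031, Int.cast_ofNat, Int.cast_neg]
  norm_num
  ring

/-- **The sixth-moment integral is positive.** -/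
theorem integral_vortSq2_mul_stretching_pos :
    0 < ∫ ξ, torusVorticitySqAt fld ξ ^ 2 * torusStretchingDensity fld ξ := by
  rw [integral_vortSq2_mul_stretching]
  have hX := Ia_120_pos
  have hY := Ia_102_pos
  have hZ : 0 ≤ Ia 1 0 4 := Ia_nonneg (Or.inr (by norm_num)) (by decide)
  have hW : 0 ≤ Ia 1 4 0 := Ia_nonneg (Or.inl (by norm_num)) (by decide)
  have hX3 : 0 ≤ Ia 3 2 0 := Ia_nonneg (Or.inl (by norm_num)) (by decide)
  positivity

/-- **KILL-ALL WITNESS at `q = 6` (K1-Q2, `m = 3`).** The same explicit field refutes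
`MiddleEigenvalueMomentRateBound 6 C` on `T³` for EVERY constant `C` (`λ₂ ≡ 0` and
`6∫|ω|⁴σ > 0`, door `middleEigenvalueMomentRateFails_of_nonpos_middle` at `m = 3`). Search for candidate a
priori estimates; no regularity claim. [ours] -/
theorem not_middleEigenvalueMomentRateBound_six (C : ℝ) :
    ¬ MiddleEigenvalueMomentRateBound (d := Fin 3) 6 C := by
  have hpos : 0 < 2 * ((3 : ℕ) : ℝ) *
      ∫ x, torusVorticitySqAt fld x ^ (3 - 1) * torusStretchingDensity fld x := by
    have h := integral_vortSq2_mul_stretching_pos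
    simp only [show (3 : ℕ) - 1 = 2 from rfl]
    positivity
  have h := middleEigenvalueMomentRateFails_of_nonpos_middle (m := 3) (Fintype.card_fin 3)
    isSmooth_fld isDivFree_fld middle_nonpos_fld hpos C
  have e : ((2 : ℝ) * ((3 : ℕ) : ℝ)) = 6 := by norm_num
  rw [e] at h
  exact h

/-- The same, quantified. -/
theorem middleEigenvalueMomentRate_six_killAll :
    ∀ C : ℝ, ¬ MiddleEigenvalueMomentRateBound (d := Fin 3) 6 C :=
  not_middleEigenvalueMomentRateBound_six

end KillAll

end Summit.NavierStokesRegularity.FunctionalMining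

end
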